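/-
Copyright: b2b-lace packet (numerics seat num5 = engine-B twin #2, gen 12).  Companion to
`SrwISeedTail`: the summability hypotheses of the seed enclosure `srwI_succ_mem_Icc` hold for every
majorant `B` of the even return probabilities that is eventually `≤ K m^{-s}` with `s > n + 1` — in
particular for the far-tail law of `SrwLawPoissonBessel` (`∝ m^{-d/2}`) as soon as `d ≥ 2n + 3`.
-/
import Mathlib.Analysis.PSeries
import Mathlib.Data.Nat.Choose.Bounds
import HarnessLib

/-!
# Summability of the coefficient-weighted tail majorants

`srwI_succ_mem_Icc` (file `SrwISeedTail`) encloses the lace-expansion seed `I_{n+1,0}(x)` between an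
exact partial sum and that sum plus `Σ_j C(2(M+j)+n,n) B(M+j) + Σ_j C(2(M+j)+1+n,n) B(M+j)`, for any
majorant `B` of `q_m = p_{2m}(0)` for which these two series converge.  Here we discharge the
convergence: if `0 ≤ B` and `B(m) ≤ K m^{-s}` for all large `m` with `s > n + 1`, both series are
summable (`summable_choose_mul_of_eventually_le_rpow`, `a = 0, 1`).  The far-tail law
`srwLaw_two_mul_zero_le_farTail` is `O(m^{-d/2})`, and `d/2 > n + 1` is exactly the standing
hypothesis `d ≥ 2n + 3` of the series form.  [folklore]
-/

namespace Literature.Probability.FitznerVanDerHofstad2017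

open Finset Real

/-- Weighted p-series comparison: if `0 ≤ B(M+j) ≤ K (M+j)^{-s}` for all `j`, `M ≥ 1`, `a ≤ 1` and
`s > n + 1`, then `Σ_j C(2(M+j)+a+n, n) B(M+j)` converges. [folklore] -/
theorem summable_choose_mul_of_le_rpow {n M a : ℕ} (hM : 1 ≤ M) (ha : a ≤ 1) {B : ℕ → ℝ}
    {K s : ℝ} (hs : (n : ℝ) + 1 < s) (hB0 : ∀ j, 0 ≤ B (M + j))
    (hB : ∀ j, B (M + j) ≤ K * ((M + j : ℕ) : ℝ) ^ (-s)) :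
    Summable fun j => (((2 * (M + j) + a + n).choose n : ℕ) : ℝ) * B (M + j) := by
  have hcmp : Summable fun j => K * ((3 : ℝ) + n) ^ n * ((M + j : ℕ) : ℝ) ^ ((n : ℝ) - s) := by
    have h1 : Summable fun m : ℕ => (m : ℝ) ^ ((n : ℝ) - s) :=
      Real.summable_nat_rpow.2 (by linarith)
    have h2 := (summable_nat_add_iff M).2 h1
    simpa [add_comm] using (h2.mul_left (K * ((3 : ℝ) + n) ^ n))
  refine Summable.of_nonneg_of_le (fun j => mul_nonneg (Nat.cast_nonneg _) (hB0 j)) (fun j => ?_) hcmp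
  have hm1 : (1 : ℝ) ≤ ((M + j : ℕ) : ℝ) := by exact_mod_cast (show 1 ≤ M + j by omega)
  have hm0 : (0 : ℝ) < ((M + j : ℕ) : ℝ) := by linarith
  have hc : (((2 * (M + j) + a + n).choose n : ℕ) : ℝ) ≤ (((3 : ℝ) + n) * ((M + j : ℕ) : ℝ)) ^ n := by
    have h1 : (((2 * (M + j) + a + n).choose n : ℕ) : ℝ) ≤ (((2 * (M + j) + a + n : ℕ) : ℝ)) ^ n := by
      exact_mod_cast Nat.choose_le_pow _ _
    refine h1.trans (pow_le_pow_left₀ (by positivity) ?_ n)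
    have h3 : (2 * (M + j) + a + n : ℕ) ≤ (3 + n) * (M + j) := by nlinarith
    exact_mod_cast h3
  calc (((2 * (M + j) + a + n).choose n : ℕ) : ℝ) * B (M + j)
      ≤ (((3 : ℝ) + n) * ((M + j : ℕ) : ℝ)) ^ n * (K * ((M + j : ℕ) : ℝ) ^ (-s)) :=
        mul_le_mul hc (hB j) (hB0 j) (by positivity)
    _ = K * ((3 : ℝ) + n) ^ n * ((M + j : ℕ) : ℝ) ^ ((n : ℝ) - s) := by
        rw [mul_pow, sub_eq_add_neg, Real.rpow_add hm0, Real.rpow_natCast]; ring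

/-- **Summability of the weighted tail majorant** (the `hBe` / `hBo` hypotheses of
`srwI_succ_mem_Icc`): if `0 ≤ B` and `B(m) ≤ K m^{-s}` for all `m ≥ M₀` with `s > n + 1`, then for
every `M` and `a ≤ 1` the series `Σ_j C(2(M+j)+a+n, n) B(M+j)` converges. [folklore] -/
theorem summable_choose_mul_of_eventually_le_rpow {n a : ℕ} (ha : a ≤ 1) {B : ℕ → ℝ}
    (hB0 : ∀ m, 0 ≤ B m) {M₀ : ℕ} {K s : ℝ} (hs : (n : ℝ) + 1 < s)
    (hB : ∀ m, M₀ ≤ m → B m ≤ K * (m : ℝ) ^ (-s)) (M : ℕ) :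
    Summable fun j => (((2 * (M + j) + a + n).choose n : ℕ) : ℝ) * B (M + j) := by
  -- shift the series by `L = M₀ + 1` terms and apply the previous lemma from `M + L ≥ 1`
  set L := M₀ + 1 with hL
  have hshift : Summable fun j => (((2 * ((M + L) + j) + a + n).choose n : ℕ) : ℝ) * B ((M + L) + j) :=
    summable_choose_mul_of_le_rpow (M := M + L) (by omega) ha hs (fun j => hB0 _)
      (fun j => hB _ (by omega))
  rw [← summable_nat_add_iff L]
  refine hshift.congr fun j => ?_
  simp only [show M + L + j = M + (j + L) by omega]

end Literature.Probability.FitznerVanDerHofstad2017
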